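import Literature.IUT.LogVolume.Theorem110GenuineStepII
import Literature.IUT.HodgeTheaters.InitialThetaDataKGaloisProofs
import Literature.IUT.HodgeTheaters.InitialThetaDataTorsionField
import HarnessLib

/-!
# [IUTchIV] Thm. 1.10, Step (ii) for the field `K` of an ARBITRARY collection of initial Θ-data over the
# Legendre curve of a `λ`-line point (the form consumed per genuine Θ-volume datum)

Mochizuki, *Inter-universal Teichmüller theory IV*, RIMS manuscript (Apr. 2020; = PRIMS **57** (2021)),
Thm. 1.10 Step (ii) p. 24, for the tower `F_tpd ⊆ F ⊆ K` where ([IUTchI] Def. 3.1 (c), kurims p. 62)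
"`K ⊆ F̄` … the finite Galois extension of `F` determined by the kernel of this homomorphism
[`G_F → GL₂(𝔽_l)`]". The companion `Theorem110GenuineStepII.lean` proves the `K`-level different bound for
`K` PRESENTED by an `F`-embedding `ψ : K → AlgebraicClosure F` inside the `l`-division field; a genuine
Θ-volume datum (`Cor22.ThetaVolumeDatumAt`, abc-iut-S2) instead carries abc-iut-L5-t2's
`InitialThetaData F K F̄ E_F l Pb` with an ARBITRARY algebraic closure `F̄` and the clause
`range_K_iff : x ∈ K ↔ ∀ σ ∈ G_F, (σ fixes E_F[l](F̄)) → σ x = x`. This file supplies the transport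
(an `F`-isomorphism `F̄ ≅ AlgebraicClosure F` carries `l`-torsion-fixing automorphisms to the kernel of the
tree's `galoisRepTorsion`, abc-iut-L5-t7/L5-t12's `fixesTorsion_iff_mem_ker`) and states the bound for the
datum's `K`:

* `fixesTorsion_conj` — torsion-fixing is stable under conjugation by `F̄ ≃ₐ[F] F̄'`;
* `ker_galoisRepTorsion_le_fixingSubgroup_of_initialThetaData` — for `D : InitialThetaData F K F̄ E_F l Pb`
  and `ι : F̄ ≃ₐ[F] AlgebraicClosure F`, `ker ρ̄_{E_F,l} ≤ Gal(AlgebraicClosure F / ι(K))`;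
* `logDiff_add_logCondOver_le_of_initialThetaData`, `logDiff_le_of_initialThetaData` — **Step (ii) for the
  datum's `K`**: `log(𝔡^K) + log(𝔣^K) ≤ log(𝔡^{F_tpd}) + log(𝔣^{F_tpd}) + log(2^11·3^3·5^2) + 2·log(l)` and
  `log(𝔡^K) ≤ log(𝔡^{F_tpd}) + log(𝔣^{F_tpd}) + 2·log(l) + 21`, for EVERY collection of initial Θ-data over
  the Legendre curve of `λ` with theta field `F` and prime `l ≥ 7` (`K` Galois over `F` by [IUTchI]
  Rmk. 3.1.5, the tree's `InitialThetaData.isGalois_fieldOfModuli_K`).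

Theorems only; classical; TAKES NO SIDE on [IUTchIII] Cor. 3.12.
-/

noncomputable section

open scoped Classical

namespace Literature.IUT.LogVolume

namespace Cor22

open NumberField IsDedekindDomain Literature.NumberTheory.DiophantineGeometry.GenEll
open Literature.NumberTheory.EllipticCurves Literature.IUT.HodgeTheaters WeierstrassCurve Field

/-! ## Transport of torsion-fixing automorphisms between algebraic closures -/

section Transport

variable {F : Type} [Field F] (E : WeierstrassCurve F) (l : ℕ)
  {Ω Ω' : Type} [Field Ω] [Algebra F Ω] [Field Ω'] [Algebra F Ω']

/-- The Galois action along a composite is the composite of the actions (`Point.map_map`).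
[cite: SilvermanAEC2009, VIII.§1] -/
theorem galoisAct_trans (σ : Ω ≃ₐ[F] Ω) (τ : Ω ≃ₐ[F] Ω) (Q : GeomPoints Ω E) :
    galoisAct E (σ.trans τ) Q = galoisAct E τ (galoisAct E σ Q) := by
  unfold galoisAct
  rw [Affine.Point.map_map]
  rfl

/-- **Torsion-fixing is stable under conjugation**: if `σ'` fixes `E[l](Ω')` then `ι ∘ σ' ∘ ι⁻¹` fixes
`E[l](Ω)` for any `F`-isomorphism `ι : Ω ≃ₐ[F] Ω'` (transport of points along `ι`, Silverman VIII.§1).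
[cite: SilvermanAEC2009, VIII.§1] -/
theorem fixesTorsion_conj (ι : Ω ≃ₐ[F] Ω') {σ' : Ω' ≃ₐ[F] Ω'} (hσ' : FixesTorsion (Fbar := Ω') E l σ') :
    FixesTorsion (Fbar := Ω) E l ((ι.trans σ').trans ι.symm) := by
  intro Q hQ
  -- transport `Q` to `Ω'`
  set Q' : GeomPoints Ω' E := Affine.Point.map (W' := E.toAffine) (ι : Ω →ₐ[F] Ω') Q with hQ'
  have hQ'l : (l : ℤ) • Q' = 0 := by rw [hQ', ← map_zsmul, hQ, map_zero]
  have hfix : galoisAct E σ' Q' = Q' := hσ' Q' hQ'l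
  unfold galoisAct at hfix ⊢
  have hcomp : (((ι.trans σ').trans ι.symm : Ω ≃ₐ[F] Ω) : Ω →ₐ[F] Ω) =
      ((ι.symm : Ω' ≃ₐ[F] Ω) : Ω' →ₐ[F] Ω).comp
        (((σ' : Ω' ≃ₐ[F] Ω') : Ω' →ₐ[F] Ω').comp (ι : Ω →ₐ[F] Ω')) := by
    ext x; rfl
  rw [hcomp, ← Affine.Point.map_map, ← Affine.Point.map_map]
  change Affine.Point.map (W' := E.toAffine) ((ι.symm : Ω' ≃ₐ[F] Ω) : Ω' →ₐ[F] Ω)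
      (Affine.Point.map (W' := E.toAffine) ((σ' : Ω' ≃ₐ[F] Ω') : Ω' →ₐ[F] Ω') Q') = Q
  rw [hfix, hQ', Affine.Point.map_map]
  have hid : ((ι.symm : Ω' ≃ₐ[F] Ω) : Ω' →ₐ[F] Ω).comp (ι : Ω →ₐ[F] Ω') = AlgHom.id F Ω := by
    ext x; exact ι.symm_apply_apply x
  rw [hid]
  cases Q <;> rfl

end Transport

/-! ## The kernel of `ρ̄_{E_F,l}` fixes the image of the datum's `K` -/

section Datum

variable {P : NFPoint} {F : Type} [Field F] [NumberField F] [Algebra P.F F]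
  {K : Type} [Field K] [NumberField K] [Algebra F K]
  {Fbar : Type} [Field Fbar] [Algebra F Fbar] [Algebra K Fbar]
  {E : WeierstrassCurve F} [E.IsElliptic] {l : ℕ} {Pb : BadPlacePredicates K}

/-- For initial Θ-data `D` (so `K ⊆ F̄` is cut out by `Ker(G_F → GL₂(𝔽_l))`, Def. 3.1 (c)) and any
`F`-isomorphism `ι : F̄ ≅ AlgebraicClosure F`, every element of the kernel of the tree's mod-`l`
representation `ρ̄_{E,l}` fixes `ι(K)` pointwise. [claim: Mochizuki2012, status: disputed] -/
theorem ker_galoisRepTorsion_le_fixingSubgroup_of_initialThetaData (D : InitialThetaData F K Fbar E l Pb)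
    (ι : Fbar ≃ₐ[F] AlgebraicClosure F) :
    (E.galoisRepTorsion (l : ℤ)).ker ≤
      (((ι : Fbar →ₐ[F] AlgebraicClosure F).comp
        (@IsScalarTower.toAlgHom F K Fbar _ _ _ _ _ _ D.isScalarTower)).fieldRange).fixingSubgroup := by
  haveI := D.isScalarTower
  intro σ' hσ'
  -- read `σ'` as an `F`-algebra automorphism of `AlgebraicClosure F`
  let σe : AlgebraicClosure F ≃ₐ[F] AlgebraicClosure F := σ'
  have hfix' : FixesTorsion (Fbar := AlgebraicClosure F) E l σe := (fixesTorsion_iff_mem_ker E l σ').2 hσ'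
  have hfix : FixesTorsion (Fbar := Fbar) E l ((ι.trans σe).trans ι.symm) := fixesTorsion_conj E l ι hfix'
  refine (IntermediateField.mem_fixingSubgroup_iff _ σe).2 fun x hx => ?_
  rw [AlgHom.mem_fieldRange] at hx
  obtain ⟨k, rfl⟩ := hx
  have hk := (D.range_K_iff (algebraMap K Fbar k)).1 ⟨k, rfl⟩ _ hfix
  -- `hk : ι.symm (σe (ι (algebraMap K F̄ k))) = algebraMap K F̄ k`; apply `ι`
  have hk' : ι (ι.symm (σe (ι (algebraMap K Fbar k)))) = ι (algebraMap K Fbar k) := congrArg ι hk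
  rw [AlgEquiv.apply_symm_apply] at hk'
  exact hk'

/-- **`K/F` is Galois** for initial Θ-data ([IUTchI] Rmk. 3.1.5: `K/F_mod` Galois, tree
`InitialThetaData.isGalois_fieldOfModuli_K`; hence over the intermediate field `F`).
[claim: Mochizuki2012, status: disputed] -/
theorem isGalois_F_K_of_initialThetaData (D : InitialThetaData F K Fbar E l Pb) : IsGalois F K := by
  haveI := D.isGalois_fieldOfModuli_K
  exact IsGalois.tower_top_of_isGalois (fieldOfModuli E) F K

/-- **[IUTchIV] Thm. 1.10 Step (ii) for the `K` of ANY initial Θ-data over the Legendre curve of `λ` with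
theta field `F` and `l ≥ 7`** (`λ`-line currency): `log(𝔡^K) + log(𝔣^K) ≤ log(𝔡^{F_tpd}) + log(𝔣^{F_tpd}) +
log(2^11·3^3·5^2) + 2·log(l)`. [claim: Mochizuki2012, status: disputed] -/
theorem logDiff_add_logCondOver_le_of_initialThetaData (hU : P.InU) (hF : IsThetaField P F)
    [Algebra P.F K] [IsScalarTower P.F F K] [hE : (thetaCurve P F).IsElliptic]
    {Pb : BadPlacePredicates K} (D : InitialThetaData F K Fbar (thetaCurve P F) l Pb) (h7 : 7 ≤ l) :
    (extend P K).logDiff + logCondOver P {2, l} K ≤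
      P.logDiff + logCondAvoid P {2, l} + (Real.log (2 ^ 11 * 3 ^ 3 * 5 ^ 2) + 2 * Real.log l) := by
  haveI := D.isScalarTower
  haveI := D.isAlgClosure
  haveI : IsGalois F K := isGalois_F_K_of_initialThetaData D
  let ι : Fbar ≃ₐ[F] AlgebraicClosure F := IsAlgClosure.equiv F Fbar (AlgebraicClosure F)
  let ψ : K →ₐ[F] AlgebraicClosure F :=
    (ι : Fbar →ₐ[F] AlgebraicClosure F).comp (IsScalarTower.toAlgHom F K Fbar)
  have hK := ker_galoisRepTorsion_le_fixingSubgroup_of_initialThetaData D ι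
  have h := ndeg_differentDivisor_add_logCondOver_thetaTower_le ψ hU hF D.l_prime h7 hK
  have hK' : (extend P K).logDiff = ndeg K (differentDivisor K) :=
    logDiff_eq_ndeg_differentDivisor (extend P K)
  rw [hK']
  exact h

/-- **`log(𝔡^K) ≤ log(𝔡^{F_tpd}) + log(𝔣^{F_tpd}) + 2·log(l) + 21` for the `K` of any initial Θ-data over
the Legendre curve of `λ` with theta field `F` and `l ≥ 7`** — the `K`-level different input of Steps (iii),
(v), (viii) (`Thm110Numerics.stepii_K_le_tpd_add`), UNCONDITIONAL for every genuine Θ-volume datum.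
[claim: Mochizuki2012, status: disputed] -/
theorem logDiff_le_of_initialThetaData (hU : P.InU) (hF : IsThetaField P F)
    [Algebra P.F K] [IsScalarTower P.F F K] [hE : (thetaCurve P F).IsElliptic]
    {Pb : BadPlacePredicates K} (D : InitialThetaData F K Fbar (thetaCurve P F) l Pb) (h7 : 7 ≤ l) :
    (extend P K).logDiff ≤ P.logDiff + logCondAvoid P {2, l} + 2 * Real.log l + 21 := by
  have h := logDiff_add_logCondOver_le_of_initialThetaData hU hF D h7
  have h0 : 0 ≤ logCondOver P {2, l} K := logCondOver_nonneg P {2, l} K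
  have h21 := log_two_pow_eleven_mul_le
  linarith

end Datum

end Cor22

end Literature.IUT.LogVolume

end
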